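import Literature.MathematicalPhysics.QuantumFieldTheory.OneCharacterTwistBound
import Literature.MathematicalPhysics.QuantumFieldTheory.TwistedSectorExpansion
import Literature.MathematicalPhysics.QuantumFieldTheory.VortexTwistPlaneSymmetry
import HarnessLib

/-!
# Tomboulis's Proposition IV.1 for the spin cut-off `j ≤ 1`: `|Z⁻_Λ| ≤ Z_Λ` by reflection positivity

E. T. Tomboulis, arXiv:0707.2179, Prop. IV.1, eq. (4.6) (`Z⁻_Λ({c_j}) ≤ Z_Λ({c_j})` for `c_j ≥ 0`),
proved in App. A §5 by the odd-sector expansion (A.17)–(A.18) (`TwistedSectorExpansion`) and "every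
term in the sum (A.18) is manifestly non-negative by RP in `π`". `OneCharacterTwistBound` makes this a
tree theorem for the spin cut-off `J = 1` of `TomboulisVortexDecimation` (one non-trivial character);
this file does the same for the cut-off `J = 2`, i.e. the characters `χ_{1/2}` AND `χ_1` (Tomboulis's
`j ≤ 1`; the "`j ≤ 1` box" of the exact censuses): `f = 1 + 2c_{1/2} χ_{1/2} + 3c_1 χ_1`,
`S^{1/2} = 2c_{1/2} χ_{1/2}`, `S^1 = 1 + 3c_1 χ_1`, with `χ_{1/2}(U) = Re tr U =: r` and
`χ_1(U) = r² - 1`.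

## Main statements

* `tSector_two_nonneg` — the RP step: `L` even, `c_{1/2}, c_1 ≥ 0`, `V` crossing, `Q ⊆ V` ⟹ the
  `Q`-sector term `tSector d L 2 c V Q` of (A.18) is `≥ 0`.
* `torusZtw_two_le_torusZ` — **IV.1, eq. (4.6), at `J = 2`**: `Z⁻_V ≤ Z`; `neg_torusZ_le_torusZtw_two`:
  `-Z ≤ Z⁻_V`; `abs_torusZtw_two_le_torusZ`: `|Z⁻_V| ≤ Z`;
  `twistLe_two_vortexSheet_plane : TwistLe d L 2 (vortexSheet L i j _)` for every plane of the even
  torus (`d ≥ 2`, transport by `VortexTwistPlaneSymmetry`); `abs_vortexRatio_two_le_one_plane`.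

## The new ingredient: the `Sym²` Gram identity

The proof is that of `OneCharacterTwistBound` (Osterwalder–Seiler reflection in the hyperplanes
between time slices, machinery of `ConstructiveQFTWave0Proofs` / `LatticeRPMechanism`: split
`G(U) G(ΘU) W_×(U)`, Haar substitution `translate Y` on the crossing links, Gram expansion of the
crossing weights, `LatticeRP.integral_splice_mul_conj_comp_nonneg` termwise), with quadratic instead of
affine crossing weights `α_p + β_p r_p + γ_p (r_p² - 1)`, `α_p, β_p, γ_p ≥ 0`. For a crossing plaquette,
after `translate Y`, `U_p` is conjugate to `ω_p(z) ω_p(ΘU)⁻¹` (`WilsonRP.halfPlaq`,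
`plaqRe_translate_of_isCrossPlaq`); with the unitarised fundamental representation `σ`
(`CompactGroup.unitarize`) and `u = σ(ω_p(z))`, `v = σ(ω_p(ΘU))`:
`r_p = Σ_{kl} u_{kl} conj v_{kl} =: X`, which is REAL (`= tr` of an element of `SU(2)`,
`sum_sig_mul_conj_eq_trace`, `su2_trace_im`), and `det u = det v = 1` (`det_sig`), so
`r_p² - 1 = X² - det u · conj det v = Σ_{ι=1}^{9} w_ι q_ι(u) conj q_ι(v)` with `w_ι ∈ {1, 2}` and `q_ι`
the matrix elements of `Sym² u` (`gram_quad`, a polynomial identity) — the character `χ_1` of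
`SU(2)`, being the character of `Sym²` of the fundamental, is a positive-definite kernel. Hence
`α + β X + γ (X² - 1)` is a Gram form with nonnegative weights (`cross_factor_gram2`), and the rest is
bookkeeping.

## References

* E. T. Tomboulis, arXiv:0707.2179, Prop. IV.1 eq. (4.6), §4.1 eq. (4.7), App. A §5
  [cite: Tomboulis2007Confinement, Prop. IV.1 eq. (4.6); App. A §5].
* K. Osterwalder, E. Seiler, Ann. Phys. 110 (1978) 440–471, §2 [cite: OsterwalderSeilerAnnPhys1978, §2].

## Scope notes

Even `L` only (no between-slice reflection on odd tori); `J ≥ 3` (spins `j ≥ 3/2`) would need the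
Gram structure of the higher characters (`Sym^n` of the fundamental) in the same format — not done here.
-/

noncomputable section

open MeasureTheory Finset Real
open scoped BigOperators ComplexConjugate
open Literature.MathematicalPhysics.QuantumLattice
open Literature.RepresentationTheory.CompactGroups

namespace Literature.MathematicalPhysics.QuantumFieldTheory

namespace Tomboulis2007

open WilsonRP

variable {d L : ℕ}

/-! ### The two-character plaquette functions in the variable `r = Re tr U_p` -/

/-- The fundamental representation is continuous (plumbing). [folklore] -/
private theorem continuous_rhoFund' : Continuous rhoFund := continuous_fundamentalRep (Fin 2)

/-- `χ_{1/2}(W) = Re tr W` (plumbing). [folklore] -/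
private theorem su2Char_one_eq' (W : SU2) :
    su2Char 1 W = ((W : Matrix (Fin 2) (Fin 2) ℂ).trace).re := by
  simp only [su2Char, Nat.cast_one, Polynomial.Chebyshev.U_one, Polynomial.eval_mul,
    Polynomial.eval_ofNat, Polynomial.eval_X]
  ring

/-- `χ_1(W) = (Re tr W)² - 1` (plumbing: `U_2(x) = 4x² - 1` at `x = Re tr W / 2`). [folklore] -/
private theorem su2Char_two_eq (W : SU2) :
    su2Char 2 W = ((W : Matrix (Fin 2) (Fin 2) ℂ).trace).re ^ 2 - 1 := by
  simp only [su2Char, Nat.cast_ofNat, Polynomial.Chebyshev.U_two, Polynomial.eval_sub,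
    Polynomial.eval_mul, Polynomial.eval_ofNat, Polynomial.eval_pow, Polynomial.eval_X,
    Polynomial.eval_one]
  ring

/-- `S^{1/2} = 2 c_{1/2} χ_{1/2}` at the cut-off `j ≤ 1` (plumbing). [folklore] -/
private theorem sHalf_two (c : ℕ → ℝ) (W : SU2) : sHalf 2 c W = 2 * c 1 * su2Char 1 W := by
  unfold sHalf
  rw [show (Icc 1 2).filter (fun n => Odd n) = {1} by decide, Finset.sum_singleton]
  norm_num

/-- `S^1 = 1 + 3 c_1 χ_1` at the cut-off `j ≤ 1` (plumbing). [folklore] -/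
private theorem sInt_two (c : ℕ → ℝ) (W : SU2) : sInt 2 c W = 1 + 3 * c 2 * su2Char 2 W := by
  unfold sInt
  rw [show (Icc 1 2).filter (fun n => Even n) = {2} by decide, Finset.sum_singleton]
  norm_num

/-- `f = 1 + 2 c_{1/2} χ_{1/2} + 3 c_1 χ_1` at the cut-off `j ≤ 1` (plumbing). [folklore] -/
private theorem plaqFn_two (c : ℕ → ℝ) (W : SU2) :
    plaqFn 2 c W = 1 + 2 * c 1 * su2Char 1 W + 3 * c 2 * su2Char 2 W := by
  rw [plaqFn_eq_sInt_add_sHalf, sInt_two, sHalf_two]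
  ring

variable [NeZero L]

section RP

variable [NeZero d] [Fact (1 < L)]

/-! ### The `Q`-sector integrand as a product of quadratic plaquette weights -/

/-- Constant coefficient: `0` on `Q`, `1` elsewhere (plumbing). [folklore] -/
private def qα (V Q : Finset (Plaquette d L)) (p : Plaquette d L) : ℝ :=
  if p ∈ V then (if p ∈ Q then 0 else 1) else 1

/-- `Re tr`-coefficient: `2 c_{1/2}` off `V` and on `Q`, `0` on `V \ Q` (plumbing). [folklore] -/
private def qβ (c : ℕ → ℝ) (V Q : Finset (Plaquette d L)) (p : Plaquette d L) : ℝ :=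
  if p ∈ V then (if p ∈ Q then 2 * c 1 else 0) else 2 * c 1

/-- `χ_1`-coefficient: `3 c_1` off `V` and on `V \ Q`, `0` on `Q` (plumbing). [folklore] -/
private def qγ (c : ℕ → ℝ) (V Q : Finset (Plaquette d L)) (p : Plaquette d L) : ℝ :=
  if p ∈ V then (if p ∈ Q then 0 else 3 * c 2) else 3 * c 2

omit [NeZero L] [NeZero d] [Fact (1 < L)] in
/-- `α_p ≥ 0` (plumbing). [folklore] -/
private theorem qα_nonneg (V Q : Finset (Plaquette d L)) (p : Plaquette d L) : 0 ≤ qα V Q p := by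
  unfold qα; split_ifs <;> norm_num

omit [NeZero L] [NeZero d] [Fact (1 < L)] in
/-- `β_p ≥ 0` when `c_{1/2} ≥ 0` (plumbing). [folklore] -/
private theorem qβ_nonneg {c : ℕ → ℝ} (hc : 0 ≤ c 1) (V Q : Finset (Plaquette d L))
    (p : Plaquette d L) : 0 ≤ qβ c V Q p := by
  unfold qβ; split_ifs <;> linarith

omit [NeZero L] [NeZero d] [Fact (1 < L)] in
/-- `γ_p ≥ 0` when `c_1 ≥ 0` (plumbing). [folklore] -/
private theorem qγ_nonneg {c : ℕ → ℝ} (hc : 0 ≤ c 2) (V Q : Finset (Plaquette d L))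
    (p : Plaquette d L) : 0 ≤ qγ c V Q p := by
  unfold qγ; split_ifs <;> linarith

/-- The quadratic plaquette weight `w_p(U) = α_p + β_p r_p + γ_p (r_p² - 1)`, `r_p = Re tr U_p`
(plumbing). [folklore] -/
private def qw (c : ℕ → ℝ) (V Q : Finset (Plaquette d L)) (p : Plaquette d L)
    (U : GaugeConfig d L SU2) : ℝ :=
  qα V Q p + qβ c V Q p * plaqRe rhoFund U p + qγ c V Q p * (plaqRe rhoFund U p ^ 2 - 1)

omit [NeZero L] [NeZero d] [Fact (1 < L)] in
/-- `f(U_p) = 1 + 2c_{1/2} r_p + 3c_1 (r_p² - 1)` (plumbing). [folklore] -/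
private theorem plaqFn_two_eq (c : ℕ → ℝ) (U : GaugeConfig d L SU2) (p : Plaquette d L) :
    plaqFn 2 c (plaquetteHolonomy U p.1 p.2.1.1 p.2.1.2) =
      1 + 2 * c 1 * plaqRe rhoFund U p + 3 * c 2 * (plaqRe rhoFund U p ^ 2 - 1) := by
  rw [plaqFn_two, su2Char_one_eq', su2Char_two_eq]
  rfl

omit [NeZero L] [NeZero d] [Fact (1 < L)] in
/-- `S^{1/2}(U_p) = 2c_{1/2} r_p` (plumbing). [folklore] -/
private theorem sHalf_two_eq (c : ℕ → ℝ) (U : GaugeConfig d L SU2) (p : Plaquette d L) :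
    sHalf 2 c (plaquetteHolonomy U p.1 p.2.1.1 p.2.1.2) = 2 * c 1 * plaqRe rhoFund U p := by
  rw [sHalf_two, su2Char_one_eq']
  rfl

omit [NeZero L] [NeZero d] [Fact (1 < L)] in
/-- `S^1(U_p) = 1 + 3c_1 (r_p² - 1)` (plumbing). [folklore] -/
private theorem sInt_two_eq (c : ℕ → ℝ) (U : GaugeConfig d L SU2) (p : Plaquette d L) :
    sInt 2 c (plaquetteHolonomy U p.1 p.2.1.1 p.2.1.2) = 1 + 3 * c 2 * (plaqRe rhoFund U p ^ 2 - 1) := by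
  rw [sInt_two, su2Char_two_eq]
  rfl

omit [NeZero d] [Fact (1 < L)] in
/-- The `Q`-sector integrand at `j ≤ 1` as a product of quadratic weights over ALL plaquettes
(plumbing). [folklore] -/
private theorem tSector_two_integrand_eq_prod (c : ℕ → ℝ) {V Q : Finset (Plaquette d L)} (hQ : Q ⊆ V)
    (U : GaugeConfig d L SU2) :
    (∏ p ∈ Vᶜ, plaqFn 2 c (plaquetteHolonomy U p.1 p.2.1.1 p.2.1.2)) *
        ((∏ p ∈ Q, sHalf 2 c (plaquetteHolonomy U p.1 p.2.1.1 p.2.1.2)) *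
          ∏ p ∈ V \ Q, sInt 2 c (plaquetteHolonomy U p.1 p.2.1.1 p.2.1.2)) =
      ∏ p : Plaquette d L, qw c V Q p U := by
  rw [← Finset.prod_mul_prod_compl V (fun p => qw c V Q p U), ← Finset.prod_sdiff hQ, mul_comm]
  have h1 : ∏ p ∈ V \ Q, qw c V Q p U =
      ∏ p ∈ V \ Q, sInt 2 c (plaquetteHolonomy U p.1 p.2.1.1 p.2.1.2) :=
    Finset.prod_congr rfl fun p hp => by
      obtain ⟨hpV, hpQ⟩ := Finset.mem_sdiff.mp hp
      simp [qw, qα, qβ, qγ, hpV, hpQ, sInt_two_eq]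
  have h2 : ∏ p ∈ Q, qw c V Q p U = ∏ p ∈ Q, sHalf 2 c (plaquetteHolonomy U p.1 p.2.1.1 p.2.1.2) :=
    Finset.prod_congr rfl fun p hp => by simp [qw, qα, qβ, qγ, hQ hp, hp, sHalf_two_eq]
  have h3 : ∏ p ∈ Vᶜ, qw c V Q p U = ∏ p ∈ Vᶜ, plaqFn 2 c (plaquetteHolonomy U p.1 p.2.1.1 p.2.1.2) :=
    Finset.prod_congr rfl fun p hp => by
      simp [qw, qα, qβ, qγ, Finset.mem_compl.mp hp, plaqFn_two_eq]
  rw [h1, h2, h3]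
  ring

/-! ### Splitting into positive, reflected and crossing plaquettes -/

/-- The positive-time part `G(U) = ∏_{p positive} f(U_p)` (plumbing). [folklore] -/
private def gPos2 (c : ℕ → ℝ) (W : GaugeConfig d L SU2) : ℝ :=
  ∏ p ∈ univ.filter IsPosPlaq, (1 + 2 * c 1 * plaqRe rhoFund W p + 3 * c 2 * (plaqRe rhoFund W p ^ 2 - 1))

/-- The crossing part of the weight (plumbing). [folklore] -/
private def wCross2 (c : ℕ → ℝ) (V Q : Finset (Plaquette d L)) (W : GaugeConfig d L SU2) : ℝ :=
  ∏ p ∈ univ.filter IsCrossPlaq, qw c V Q p W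

/-- The negative plaquettes are the reflected positive ones (plumbing, as in
`OneCharacterTwistBound`). [folklore] -/
private theorem prod_neg_eq_prod_pos_timeReflect' (hL : Even L) (φ : ℝ → ℝ) (U : GaugeConfig d L SU2) :
    ∏ p ∈ univ.filter IsNegPlaq, φ (plaqRe rhoFund U p) =
      ∏ p ∈ univ.filter IsPosPlaq, φ (plaqRe rhoFund U.timeReflect p) := by
  simp_rw [plaqRe_timeReflect rhoFund continuous_rhoFund']
  symm
  refine Finset.prod_equiv plaqReflectEquiv (fun p => ?_) (fun p _ => rfl)
  simp only [Finset.mem_filter, Finset.mem_univ, true_and]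
  exact (isNegPlaq_plaqReflect_iff hL p).symm

/-- `∏_p w_p(U) = G(U) · G(ΘU) · W_×(U)` when the twist set is crossing (plumbing). [folklore] -/
private theorem prod_qw_split (hL : Even L) (c : ℕ → ℝ) {V Q : Finset (Plaquette d L)}
    (hV : ∀ p ∈ V, IsCrossPlaq p) (U : GaugeConfig d L SU2) :
    ∏ p : Plaquette d L, qw c V Q p U = gPos2 c U * gPos2 c U.timeReflect * wCross2 c V Q U := by
  rw [← Finset.prod_filter_mul_prod_filter_not univ IsCrossPlaq, mul_comm]
  unfold wCross2 gPos2
  congr 1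
  have hw : ∀ p ∈ univ.filter (fun p => ¬ IsCrossPlaq p),
      qw c V Q p U = 1 + 2 * c 1 * plaqRe rhoFund U p + 3 * c 2 * (plaqRe rhoFund U p ^ 2 - 1) := by
    intro p hp
    have hpV : p ∉ V := fun h => (Finset.mem_filter.mp hp).2 (hV p h)
    simp [qw, qα, qβ, qγ, hpV]
  rw [Finset.prod_congr rfl hw,
    ← Finset.prod_filter_mul_prod_filter_not (univ.filter fun p => ¬ IsCrossPlaq p) IsPosPlaq,
    Finset.filter_filter, Finset.filter_filter]
  have hpos : univ.filter (fun p : Plaquette d L => ¬ IsCrossPlaq p ∧ IsPosPlaq p) = univ.filter IsPosPlaq :=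
    Finset.filter_congr fun p _ =>
      ⟨fun h => h.2, fun h => ⟨fun hc => not_isPosPlaq_of_isCrossPlaq hL hc h, h⟩⟩
  have hneg : univ.filter (fun p : Plaquette d L => ¬ IsCrossPlaq p ∧ ¬ IsPosPlaq p) = univ.filter IsNegPlaq :=
    Finset.filter_congr fun p _ => ⟨fun h => ⟨h.2, h.1⟩, fun h => ⟨h.2, h.1⟩⟩
  have h4 := prod_neg_eq_prod_pos_timeReflect' hL (fun r => 1 + 2 * c 1 * r + 3 * c 2 * (r ^ 2 - 1)) U
  beta_reduce at h4
  rw [hpos, hneg, h4]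

/-! #### The Gram structure of the quadratic crossing weights

For a crossing plaquette `p`, after the substitution `translate Y`, `U_p` is conjugate to
`ω_p(z) ω_p(ΘU)⁻¹` (`z = splice_C(U, Y)`, `WilsonRP.halfPlaq`), so with the unitarised fundamental
representation `σ` and `u = σ(ω_p(z))`, `v = σ(ω_p(ΘU))` (both of determinant `1`):
`r_p = tr σ(ω_p(z) ω_p(ΘU)⁻¹) = Σ_{kl} u_{kl} conj v_{kl} =: X` (real, being the trace of an element
of `SU(2)`), and `χ_1(U_p) = X² - 1 = X² - det u · conj det v = Σ_{ι=1}^{9} w_ι q_ι(u) conj q_ι(v)` with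
`w_ι ∈ {1, 2}` and `q_ι` the matrix elements of `Sym² u` (`gram_quad`). Hence every crossing weight
`α + β r_p + γ χ_1(U_p)` with `α, β, γ ≥ 0` is a Gram kernel with nonnegative weights. -/

/-- `σ(ω_p(V))_{kl}`: the unitarised half-plaquette entries (plumbing). [folklore] -/
private def sig (p : Plaquette d L) (k l : Fin 2) (V : GaugeConfig d L SU2) : ℂ :=
  CompactGroup.unitarize rhoFund continuous_rhoFund' (halfPlaq p V) k l

omit [NeZero L] [NeZero d] [Fact (1 < L)] in
/-- The trace of an element of `SU(2)` is real (plumbing: `Wᴴ = adj W`). [folklore] -/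
private theorem su2_trace_im (W : SU2) : (((W : Matrix (Fin 2) (Fin 2) ℂ)).trace).im = 0 := by
  have hW := Matrix.mem_specialUnitaryGroup_iff.1 W.2
  have h1 : star (W : Matrix (Fin 2) (Fin 2) ℂ) * (W : Matrix (Fin 2) (Fin 2) ℂ) = 1 :=
    Unitary.star_mul_self_of_mem hW.1
  have h2 : star (W : Matrix (Fin 2) (Fin 2) ℂ) = Matrix.adjugate (W : Matrix (Fin 2) (Fin 2) ℂ) := by
    calc star (W : Matrix (Fin 2) (Fin 2) ℂ)
        = star (W : Matrix (Fin 2) (Fin 2) ℂ) * ((W : Matrix (Fin 2) (Fin 2) ℂ) *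
            Matrix.adjugate (W : Matrix (Fin 2) (Fin 2) ℂ)) := by
          rw [Matrix.mul_adjugate, hW.2, one_smul, Matrix.mul_one]
      _ = Matrix.adjugate (W : Matrix (Fin 2) (Fin 2) ℂ) := by rw [← Matrix.mul_assoc, h1, Matrix.one_mul]
  have h3 := congrArg (fun M : Matrix (Fin 2) (Fin 2) ℂ => M 0 0) h2
  simp only [Matrix.star_apply, Matrix.adjugate_fin_two, Matrix.of_apply, Matrix.cons_val',
    Matrix.cons_val_zero, Matrix.empty_val', Matrix.cons_val_fin_one, RCLike.star_def] at h3
  rw [Matrix.trace_fin_two, ← h3, Complex.add_im, Complex.conj_im]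
  ring

omit [NeZero L] [Fact (1 < L)] in
/-- `Σ_{kl} σ(g)_{kl} conj σ(h)_{kl} = tr (g h⁻¹)` for the unitarised fundamental representation
(plumbing). [folklore] -/
private theorem sum_sig_mul_conj_eq_trace (p : Plaquette d L) (z W : GaugeConfig d L SU2) :
    ∑ k, ∑ l, sig p k l z * conj (sig p k l W) =
      (((halfPlaq p z * (halfPlaq p W)⁻¹ : SU2) : Matrix (Fin 2) (Fin 2) ℂ)).trace := by
  unfold sig
  rw [← fundamentalRep_apply, ← CompactGroup.trace_unitarize rhoFund continuous_rhoFund', map_mul,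
    CompactGroup.unitarize_inv, Matrix.star_eq_conjTranspose, Matrix.trace]
  simp only [Matrix.diag_apply, Matrix.mul_apply, Matrix.conjTranspose_apply, Complex.star_def]

omit [NeZero L] [Fact (1 < L)] in
/-- … so it is real (plumbing). [folklore] -/
private theorem sum_sig_mul_conj_im (p : Plaquette d L) (z W : GaugeConfig d L SU2) :
    (∑ k, ∑ l, sig p k l z * conj (sig p k l W)).im = 0 := by
  rw [sum_sig_mul_conj_eq_trace]
  exact su2_trace_im _

omit [NeZero L] [Fact (1 < L)] in
/-- `det σ(ω_p(V)) = 1` (plumbing). [folklore] -/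
private theorem det_sig (p : Plaquette d L) (V : GaugeConfig d L SU2) :
    sig p 0 0 V * sig p 1 1 V - sig p 0 1 V * sig p 1 0 V = 1 := by
  unfold sig
  rw [← Matrix.det_fin_two, CompactGroup.unitarize_apply,
    Matrix.det_conj (CompactGroup.isUnit_unitarizer rhoFund continuous_rhoFund'), fundamentalRep_apply]
  exact (Matrix.mem_specialUnitaryGroup_iff.1 (halfPlaq p V).2).2

omit [NeZero L] [Fact (1 < L)] in
/-- `|σ_{kl}| ≤ 1` (plumbing). [folklore] -/
private theorem norm_sig_le (p : Plaquette d L) (k l : Fin 2) (V : GaugeConfig d L SU2) :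
    ‖sig p k l V‖ ≤ 1 :=
  CompactGroup.norm_unitarize_apply_le_one rhoFund continuous_rhoFund' _ k l

omit [NeZero L] [Fact (1 < L)] in
/-- `σ_{kl}` is measurable (plumbing). [folklore] -/
private theorem measurable_sig (p : Plaquette d L) (k l : Fin 2) : Measurable (sig p k l) :=
  entryMeasurable_halfPlaq rhoFund continuous_rhoFund' p k l

/-- `σ_{kl}` of a crossing plaquette depends only on the links in `P ∪ C` (plumbing). [folklore] -/
private theorem sig_congr (hL : Even L) {p : Plaquette d L} (hp : IsCrossPlaq p) (k l : Fin 2)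
    {U W : GaugeConfig d L SU2}
    (hUW : ∀ e ∈ ((posEdges ∪ crossEdges : Finset (Edge d L)) : Set (Edge d L)), U e = W e) :
    sig p k l U = sig p k l W := by
  unfold sig
  rw [halfPlaq_congr hL hp hUW]

/-- The nine quadratic Gram functions `q_ι(m)`: the matrix elements of `Sym² m` (up to the weights
`w_ι`) (plumbing). [folklore] -/
private def qfun (m : Fin 2 → Fin 2 → ℂ) : Fin 9 → ℂ :=
  ![m 0 0 * m 0 0, m 0 1 * m 0 1, m 1 0 * m 1 0, m 1 1 * m 1 1,
    m 0 0 * m 0 1, m 0 0 * m 1 0, m 0 1 * m 1 1, m 1 0 * m 1 1, m 0 0 * m 1 1 + m 0 1 * m 1 0]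

/-- The weights `w_ι ∈ {1, 2}` (plumbing). [folklore] -/
private def qwt : Fin 9 → ℝ := ![1, 1, 1, 1, 2, 2, 2, 2, 1]

omit [NeZero L] [NeZero d] [Fact (1 < L)] in
/-- `w_ι ≥ 0` (plumbing). [folklore] -/
private theorem qwt_nonneg (i : Fin 9) : 0 ≤ qwt i := by
  fin_cases i <;> simp [qwt]

omit [NeZero L] [NeZero d] [Fact (1 < L)] in
/-- **The `Sym²` Gram identity**: `X² - det u · conj det v = Σ_ι w_ι q_ι(u) conj q_ι(v)` for
`X = Σ_{kl} u_{kl} conj v_{kl}` (plumbing). [folklore] -/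
private theorem gram_quad (u v : Fin 2 → Fin 2 → ℂ) :
    (∑ k, ∑ l, u k l * conj (v k l)) ^ 2 -
        (u 0 0 * u 1 1 - u 0 1 * u 1 0) * conj (v 0 0 * v 1 1 - v 0 1 * v 1 0) =
      ∑ i : Fin 9, (qwt i : ℂ) * (qfun u i * conj (qfun v i)) := by
  simp only [Fin.sum_univ_succ, Fin.sum_univ_zero, qfun, qwt, Matrix.cons_val_zero, Matrix.cons_val_succ,
    map_mul, map_add, map_sub]
  push_cast
  ring

omit [NeZero L] [NeZero d] [Fact (1 < L)] in
/-- `|q_ι(m)| ≤ 2` when the entries of `m` have modulus `≤ 1` (plumbing). [folklore] -/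
private theorem norm_qfun_le {m : Fin 2 → Fin 2 → ℂ} (hm : ∀ k l, ‖m k l‖ ≤ 1) (i : Fin 9) :
    ‖qfun m i‖ ≤ 2 := by
  have h1 : ∀ a b c d' : Fin 2, ‖m a b * m c d'‖ ≤ 1 := fun a b c d' => by
    rw [norm_mul]
    exact mul_le_one₀ (hm a b) (norm_nonneg _) (hm c d')
  fin_cases i
  all_goals simp only [qfun, Fin.zero_eta, Fin.mk_one, Fin.reduceFinMk, Matrix.cons_val_zero,
    Matrix.cons_val_one, Matrix.cons_val]
  all_goals first
    | exact (h1 _ _ _ _).trans one_le_two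
    | exact (norm_add_le _ _).trans (by linarith [h1 0 0 1 1, h1 0 1 1 0])

/-- Index of the Gram expansion of a quadratic plaquette weight: constant, linear (`σ_{kl}`),
quadratic (`q_ι`) (plumbing). [folklore] -/
private abbrev GIdx2 : Type := Unit ⊕ (Fin 2 × Fin 2) ⊕ Fin 9

/-- The Gram functions (plumbing). [folklore] -/
private def gramA2 (p : Plaquette d L) : GIdx2 → GaugeConfig d L SU2 → ℂ
  | Sum.inl _ => fun _ => 1
  | Sum.inr (Sum.inl kl) => if IsCrossPlaq p then sig p kl.1 kl.2 else fun _ => 0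
  | Sum.inr (Sum.inr i) => if IsCrossPlaq p then (fun V => qfun (fun k l => sig p k l V) i) else fun _ => 0

/-- The Gram weights (plumbing). [folklore] -/
private def gramW2 (c : ℕ → ℝ) (V Q : Finset (Plaquette d L)) (p : Plaquette d L) : GIdx2 → ℝ
  | Sum.inl _ => if IsCrossPlaq p then qα V Q p else 1
  | Sum.inr (Sum.inl _) => if IsCrossPlaq p then qβ c V Q p else 0
  | Sum.inr (Sum.inr i) => if IsCrossPlaq p then qγ c V Q p * qwt i else 0

omit [NeZero L] [Fact (1 < L)] in
/-- The Gram weights are nonnegative when `c_{1/2}, c_1 ≥ 0` (plumbing). [folklore] -/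
private theorem gramW2_nonneg {c : ℕ → ℝ} (hc1 : 0 ≤ c 1) (hc2 : 0 ≤ c 2) (V Q : Finset (Plaquette d L))
    (p : Plaquette d L) (j : GIdx2) : 0 ≤ gramW2 c V Q p j := by
  rcases j with _ | kl | i
  · simp only [gramW2]; split_ifs; exacts [qα_nonneg V Q p, zero_le_one]
  · simp only [gramW2]; split_ifs; exacts [qβ_nonneg hc1 V Q p, le_rfl]
  · simp only [gramW2]; split_ifs; exacts [mul_nonneg (qγ_nonneg hc2 V Q p) (qwt_nonneg i), le_rfl]

omit [NeZero L] [Fact (1 < L)] in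
/-- The Gram functions are measurable (plumbing). [folklore] -/
private theorem measurable_gramA2 (p : Plaquette d L) (j : GIdx2) : Measurable (gramA2 p j) := by
  rcases j with _ | kl | i
  · exact measurable_const
  · simp only [gramA2]
    split_ifs
    · exact measurable_sig p kl.1 kl.2
    · exact measurable_const
  · simp only [gramA2]
    split_ifs
    · fin_cases i
      all_goals simp only [qfun, Fin.zero_eta, Fin.mk_one, Fin.reduceFinMk, Matrix.cons_val_zero,
        Matrix.cons_val_one, Matrix.cons_val]
      all_goals first
        | exact (measurable_sig p _ _).mul (measurable_sig p _ _)
        | exact ((measurable_sig p _ _).mul (measurable_sig p _ _)).add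
            ((measurable_sig p _ _).mul (measurable_sig p _ _))
    · exact measurable_const

omit [NeZero L] [Fact (1 < L)] in
/-- The Gram functions are bounded by `2` (plumbing). [folklore] -/
private theorem norm_gramA2_le (p : Plaquette d L) (j : GIdx2) (W : GaugeConfig d L SU2) :
    ‖gramA2 p j W‖ ≤ 2 := by
  rcases j with _ | kl | i
  · simp [gramA2]
  · simp only [gramA2]
    split_ifs
    · exact (norm_sig_le p kl.1 kl.2 W).trans one_le_two
    · simp
  · simp only [gramA2]
    split_ifs
    · exact norm_qfun_le (fun k l => norm_sig_le p k l W) i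
    · simp

/-- The Gram functions depend only on the links in `P ∪ C` (plumbing). [folklore] -/
private theorem dependsOn_gramA2 (hL : Even L) (p : Plaquette d L) (j : GIdx2) :
    DependsOn (gramA2 p j) ((posEdges ∪ crossEdges : Finset (Edge d L)) : Set (Edge d L)) := by
  intro U W hUW
  rcases j with _ | kl | i
  · rfl
  · simp only [gramA2]
    split_ifs with hp
    · exact sig_congr hL hp kl.1 kl.2 hUW
    · rfl
  · simp only [gramA2]
    split_ifs with hp
    · have h : (fun k l => sig p k l U) = fun k l => sig p k l W :=
        funext fun k => funext fun l => sig_congr hL hp k l hUW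
      simp only [h]
    · rfl

/-- **The Gram identity for one crossing plaquette** (quadratic weights): after `translate Y`,
`α_p + β_p r_p + γ_p χ_1(U_p) = Σ_j W_{p,j} A_{p,j}(z) conj A_{p,j}(ΘU)` with `W ≥ 0` (plumbing).
[folklore] -/
private theorem cross_factor_gram2 (hL : Even L) (c : ℕ → ℝ) (V Q : Finset (Plaquette d L))
    (U Y : GaugeConfig d L SU2) {p : Plaquette d L} (hp : IsCrossPlaq p) :
    ((qw c V Q p (translate Y U) : ℝ) : ℂ) =
      ∑ j : GIdx2, ((gramW2 c V Q p j : ℝ) : ℂ) *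
        (gramA2 p j (LatticeRP.splice crossEdges (U, Y)) * conj (gramA2 p j U.timeReflect)) := by
  set z := LatticeRP.splice crossEdges (U, Y) with hz
  set X : ℂ := ∑ k, ∑ l, sig p k l z * conj (sig p k l U.timeReflect) with hX
  have hr : ((plaqRe rhoFund (translate Y U) p : ℝ) : ℂ) = X := by
    have h1 : plaqRe rhoFund (translate Y U) p = X.re := by
      rw [plaqRe_translate_of_isCrossPlaq rhoFund hL continuous_rhoFund' U Y hp, hX, Complex.re_sum]
      refine Finset.sum_congr rfl fun k _ => ?_
      rw [Complex.re_sum]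
      rfl
    rw [h1]
    exact Complex.ext (by simp) (by rw [Complex.ofReal_im, hX, sum_sig_mul_conj_im])
  have hdet : (1 : ℂ) = (sig p 0 0 z * sig p 1 1 z - sig p 0 1 z * sig p 1 0 z) *
      conj (sig p 0 0 U.timeReflect * sig p 1 1 U.timeReflect -
        sig p 0 1 U.timeReflect * sig p 1 0 U.timeReflect) := by
    rw [det_sig, det_sig, map_one, mul_one]
  -- the right-hand side, block by block
  rw [Fintype.sum_sum_type, Fintype.sum_sum_type, Fintype.sum_unique, Fintype.sum_prod_type]
  simp only [gramW2, gramA2, if_pos hp, map_one, mul_one]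
  have hβ : ∑ k : Fin 2, ∑ l : Fin 2, ((qβ c V Q p : ℝ) : ℂ) * (sig p k l z * conj (sig p k l U.timeReflect)) =
      ((qβ c V Q p : ℝ) : ℂ) * X := by
    rw [hX, Finset.mul_sum]
    exact Finset.sum_congr rfl fun k _ => by rw [Finset.mul_sum]
  have hγ : ∑ i : Fin 9, ((qγ c V Q p * qwt i : ℝ) : ℂ) *
      (qfun (fun k l => sig p k l z) i * conj (qfun (fun k l => sig p k l U.timeReflect) i)) =
      ((qγ c V Q p : ℝ) : ℂ) * (X ^ 2 - 1) := by
    rw [hdet, hX, gram_quad, Finset.mul_sum]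
    exact Finset.sum_congr rfl fun i _ => by push_cast; ring
  rw [hβ, hγ]
  unfold qw
  push_cast
  rw [hr]
  ring

/-- The crossing weight, after `translate Y`, as a sum of Gram products (plumbing). [folklore] -/
private theorem wCross2_translate_gram (hL : Even L) (c : ℕ → ℝ) (V Q : Finset (Plaquette d L))
    (U Y : GaugeConfig d L SU2) :
    ((wCross2 c V Q (translate Y U) : ℝ) : ℂ) =
      ∑ x ∈ Fintype.piFinset (fun _ : Plaquette d L => (univ : Finset GIdx2)),
        ((∏ p, gramW2 c V Q p (x p) : ℝ) : ℂ) *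
          ((∏ p, gramA2 p (x p) (LatticeRP.splice crossEdges (U, Y))) *
            conj (∏ p, gramA2 p (x p) U.timeReflect)) := by
  unfold wCross2
  rw [Finset.prod_filter, Complex.ofReal_prod]
  have hfac : ∀ p : Plaquette d L,
      (((if IsCrossPlaq p then qw c V Q p (translate Y U) else 1 : ℝ)) : ℂ) =
        ∑ j : GIdx2, ((gramW2 c V Q p j : ℝ) : ℂ) *
          (gramA2 p j (LatticeRP.splice crossEdges (U, Y)) * conj (gramA2 p j U.timeReflect)) := by
    intro p
    by_cases hp : IsCrossPlaq p
    · rw [if_pos hp]; exact cross_factor_gram2 hL c V Q U Y hp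
    · rw [if_neg hp, Fintype.sum_sum_type, Fintype.sum_sum_type, Fintype.sum_unique]
      simp [gramW2, gramA2, hp]
  simp_rw [hfac]
  rw [Finset.prod_univ_sum]
  refine Finset.sum_congr rfl fun x _ => ?_
  rw [Finset.prod_mul_distrib, Finset.prod_mul_distrib, Complex.ofReal_prod, map_prod]


/-! #### Assembly: `T_Q ≥ 0` at the cut-off `j ≤ 1` -/

/-- `Γ_x = ∏_p W_{p, x_p}` (plumbing). [folklore] -/
private def gramΓ2 (c : ℕ → ℝ) (V Q : Finset (Plaquette d L)) (x : Plaquette d L → GIdx2) : ℝ :=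
  ∏ p, gramW2 c V Q p (x p)

/-- `Φ_x(W) = G(W) ∏_p A_{p, x_p}(W)` (plumbing). [folklore] -/
private def gramΦ2 (c : ℕ → ℝ) (x : Plaquette d L → GIdx2) (W : GaugeConfig d L SU2) : ℂ :=
  (gPos2 c W : ℂ) * ∏ p, gramA2 p (x p) W

omit [Fact (1 < L)] in
/-- `Γ_x ≥ 0` when `c_{1/2}, c_1 ≥ 0` (plumbing). [folklore] -/
private theorem gramΓ2_nonneg {c : ℕ → ℝ} (hc1 : 0 ≤ c 1) (hc2 : 0 ≤ c 2) (V Q : Finset (Plaquette d L))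
    (x : Plaquette d L → GIdx2) : 0 ≤ gramΓ2 c V Q x :=
  Finset.prod_nonneg fun p _ => gramW2_nonneg hc1 hc2 V Q p (x p)

omit [NeZero L] [NeZero d] [Fact (1 < L)] in
/-- Measurability of `U ↦ r_p(U)` (plumbing). [folklore] -/
private theorem measurable_plaqRe' (p : Plaquette d L) :
    Measurable fun U : GaugeConfig d L SU2 => plaqRe rhoFund U p :=
  measurable_plaqRe rhoFund continuous_rhoFund' p

omit [NeZero L] [NeZero d] [Fact (1 < L)] in
/-- `|r_p| ≤ 2` (plumbing). [folklore] -/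
private theorem abs_plaqRe' (U : GaugeConfig d L SU2) (p : Plaquette d L) : |plaqRe rhoFund U p| ≤ 2 := by
  have h := abs_plaqRe_le rhoFund continuous_rhoFund' U p
  norm_num at h
  exact_mod_cast h

omit [NeZero L] [NeZero d] [Fact (1 < L)] in
/-- A product of quadratic functions of the plaquette variables is measurable (plumbing). [folklore] -/
private theorem measurable_prod_quad (s : Finset (Plaquette d L)) (α β γ : Plaquette d L → ℝ) :
    Measurable fun U : GaugeConfig d L SU2 =>
      ∏ p ∈ s, (α p + β p * plaqRe rhoFund U p + γ p * (plaqRe rhoFund U p ^ 2 - 1)) :=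
  Finset.measurable_prod s fun p _ =>
    (measurable_const.add (measurable_const.mul (measurable_plaqRe' p))).add
      (measurable_const.mul (((measurable_plaqRe' p).pow_const 2).sub measurable_const))

omit [NeZero L] [NeZero d] [Fact (1 < L)] in
/-- … and bounded by `∏ (|α_p| + 2|β_p| + 3|γ_p|)` (plumbing). [folklore] -/
private theorem abs_prod_quad_le (s : Finset (Plaquette d L)) (α β γ : Plaquette d L → ℝ)
    (U : GaugeConfig d L SU2) :
    |∏ p ∈ s, (α p + β p * plaqRe rhoFund U p + γ p * (plaqRe rhoFund U p ^ 2 - 1))| ≤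
      ∏ p ∈ s, (|α p| + 2 * |β p| + 3 * |γ p|) := by
  rw [Finset.abs_prod]
  refine Finset.prod_le_prod (fun p _ => abs_nonneg _) fun p _ => ?_
  have hr := abs_plaqRe' U p
  have hr2 : |plaqRe rhoFund U p ^ 2 - 1| ≤ 3 := by
    rw [abs_le] at hr ⊢
    constructor <;> nlinarith [hr.1, hr.2, sq_nonneg (plaqRe rhoFund U p)]
  calc |α p + β p * plaqRe rhoFund U p + γ p * (plaqRe rhoFund U p ^ 2 - 1)|
      ≤ |α p + β p * plaqRe rhoFund U p| + |γ p * (plaqRe rhoFund U p ^ 2 - 1)| := abs_add_le _ _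
    _ ≤ (|α p| + |β p * plaqRe rhoFund U p|) + |γ p * (plaqRe rhoFund U p ^ 2 - 1)| := by
        gcongr; exact abs_add_le _ _
    _ = |α p| + |β p| * |plaqRe rhoFund U p| + |γ p| * |plaqRe rhoFund U p ^ 2 - 1| := by
        rw [abs_mul, abs_mul]
    _ ≤ |α p| + |β p| * 2 + |γ p| * 3 := by
        gcongr
    _ = |α p| + 2 * |β p| + 3 * |γ p| := by ring

omit [Fact (1 < L)] in
/-- `G` is measurable (plumbing). [folklore] -/
private theorem measurable_gPos2 (c : ℕ → ℝ) : Measurable (gPos2 (d := d) (L := L) c) :=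
  measurable_prod_quad _ (fun _ => 1) (fun _ => 2 * c 1) (fun _ => 3 * c 2)

omit [Fact (1 < L)] in
/-- `G` is bounded (plumbing). [folklore] -/
private theorem abs_gPos2_le (c : ℕ → ℝ) (W : GaugeConfig d L SU2) :
    |gPos2 c W| ≤ ∏ _p ∈ (univ : Finset (Plaquette d L)).filter IsPosPlaq,
      (|(1 : ℝ)| + 2 * |2 * c 1| + 3 * |3 * c 2|) :=
  abs_prod_quad_le _ (fun _ => 1) (fun _ => 2 * c 1) (fun _ => 3 * c 2) W

/-- `G` depends only on the positive links (plumbing). [folklore] -/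
private theorem dependsOn_gPos2 (c : ℕ → ℝ) {U W : GaugeConfig d L SU2}
    (hUW : ∀ e ∈ ((posEdges : Finset (Edge d L)) : Set (Edge d L)), U e = W e) :
    gPos2 c U = gPos2 c W := by
  unfold gPos2
  refine Finset.prod_congr rfl fun p hp => ?_
  have hpos : IsPosPlaq p := (Finset.mem_filter.mp hp).2
  obtain ⟨h1, h2, h3, h4⟩ := isPosEdge_of_isPosPlaq hpos
  have h : ∀ e, IsPosEdge e → U e = W e := fun e he => hUW e (by simpa using he)
  simp only [plaqRe, plaquetteHolonomy, h _ h1, h _ h2, h _ h3, h _ h4]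

omit [Fact (1 < L)] in
/-- `Φ_x` is measurable (plumbing). [folklore] -/
private theorem measurable_gramΦ2 (c : ℕ → ℝ) (x : Plaquette d L → GIdx2) : Measurable (gramΦ2 c x) :=
  (Complex.measurable_ofReal.comp (measurable_gPos2 c)).mul
    (Finset.measurable_prod _ fun p _ => measurable_gramA2 p (x p))

omit [Fact (1 < L)] in
/-- `Φ_x` is bounded (plumbing). [folklore] -/
private theorem norm_gramΦ2_le (c : ℕ → ℝ) (x : Plaquette d L → GIdx2) (W : GaugeConfig d L SU2) :
    ‖gramΦ2 c x W‖ ≤ (∏ _p ∈ (univ : Finset (Plaquette d L)).filter IsPosPlaq,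
      (|(1 : ℝ)| + 2 * |2 * c 1| + 3 * |3 * c 2|)) * (2 : ℝ) ^ (univ : Finset (Plaquette d L)).card := by
  unfold gramΦ2
  rw [norm_mul, Complex.norm_real, Real.norm_eq_abs]
  have h1 : ‖∏ p, gramA2 p (x p) W‖ ≤ (2 : ℝ) ^ (univ : Finset (Plaquette d L)).card := by
    rw [norm_prod, ← Finset.prod_const]
    exact Finset.prod_le_prod (fun p _ => norm_nonneg _) fun p _ => norm_gramA2_le p (x p) W
  exact mul_le_mul (abs_gPos2_le c W) h1 (norm_nonneg _)
    ((abs_nonneg _).trans (abs_gPos2_le c W))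

/-- `Φ_x` depends only on the links in `P ∪ C` (plumbing). [folklore] -/
private theorem dependsOn_gramΦ2 (hL : Even L) (c : ℕ → ℝ) (x : Plaquette d L → GIdx2) :
    DependsOn (gramΦ2 c x) ((posEdges ∪ crossEdges : Finset (Edge d L)) : Set (Edge d L)) := by
  intro U W hUW
  have hP : ∀ e ∈ ((posEdges : Finset (Edge d L)) : Set (Edge d L)), U e = W e := fun e he =>
    hUW e (by rw [Finset.coe_union]; exact Or.inl he)
  unfold gramΦ2
  rw [dependsOn_gPos2 c hP]
  congr 1
  exact Finset.prod_congr rfl fun p _ => dependsOn_gramA2 hL p (x p) hUW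

/-- The doubled integrand `R(U, Y) = Σ_x Γ_x Φ_x(z) conj Φ_x(ΘU)` (plumbing). [folklore] -/
private def gramR2 (c : ℕ → ℝ) (V Q : Finset (Plaquette d L))
    (q : GaugeConfig d L SU2 × GaugeConfig d L SU2) : ℂ :=
  ∑ x ∈ Fintype.piFinset (fun _ : Plaquette d L => (univ : Finset GIdx2)),
    ((gramΓ2 c V Q x : ℝ) : ℂ) * (gramΦ2 c x (LatticeRP.splice crossEdges q) * conj (gramΦ2 c x q.1.timeReflect))

/-- **The pointwise identity**: after `translate Y`, the `Q`-sector integrand is `R(U, Y)` (plumbing).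
[folklore] -/
private theorem integrand_translate2 (hL : Even L) (c : ℕ → ℝ) {V Q : Finset (Plaquette d L)}
    (hV : ∀ p ∈ V, IsCrossPlaq p) (U Y : GaugeConfig d L SU2) :
    (((∏ p : Plaquette d L, qw c V Q p (translate Y U) : ℝ)) : ℂ) = gramR2 c V Q (U, Y) := by
  have hPC : ∀ e : Edge d L, IsPosEdge e → ¬ IsCrossEdge e :=
    fun e he hc => not_isPosEdge_of_isCrossEdge hL hc he
  have hmem : ∀ e : Edge d L, e ∈ ((posEdges : Finset (Edge d L)) : Set (Edge d L)) → IsPosEdge e :=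
    fun e he => by simpa using he
  have htr : ∀ e ∈ ((posEdges : Finset (Edge d L)) : Set (Edge d L)), translate Y U e = U e :=
    fun e he => translate_apply_of_not_isCrossEdge Y U (hPC e (hmem e he))
  have hsp : ∀ e ∈ ((posEdges : Finset (Edge d L)) : Set (Edge d L)),
      LatticeRP.splice crossEdges (U, Y) e = U e :=
    fun e he => splice_apply_of_not_isCrossEdge U Y (hPC e (hmem e he))
  have hΘtr : ∀ e ∈ ((posEdges : Finset (Edge d L)) : Set (Edge d L)),
      (translate Y U).timeReflect e = U.timeReflect e := by
    intro e he
    rw [timeReflect_apply, timeReflect_apply,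
      translate_apply_of_not_isCrossEdge Y U (not_isCrossEdge_edgeReflect hL (hmem e he))]
  have hG1 : gPos2 c (translate Y U) = gPos2 c (LatticeRP.splice crossEdges (U, Y)) := by
    rw [dependsOn_gPos2 c htr, ← dependsOn_gPos2 c hsp]
  have hG2 : gPos2 c (translate Y U).timeReflect = gPos2 c U.timeReflect := dependsOn_gPos2 c hΘtr
  rw [prod_qw_split hL c hV, Complex.ofReal_mul, Complex.ofReal_mul, wCross2_translate_gram hL c V Q U Y,
    hG1, hG2, Finset.mul_sum]
  unfold gramR2 gramΓ2 gramΦ2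
  refine Finset.sum_congr rfl fun x _ => ?_
  simp only [map_mul, Complex.conj_ofReal]
  ring

omit [Fact (1 < L)] in
/-- The doubled integrand is measurable (plumbing). [folklore] -/
private theorem measurable_gramR2 (c : ℕ → ℝ) (V Q : Finset (Plaquette d L)) :
    Measurable (gramR2 c V Q) := by
  unfold gramR2
  refine Finset.measurable_sum _ fun x _ => ?_
  have hΦ := measurable_gramΦ2 c x
  exact measurable_const.mul ((hΦ.comp (LatticeRP.measurable_splice _)).mul
    (Complex.continuous_conj.measurable.comp (hΦ.comp (measurable_timeReflect.comp measurable_fst))))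

omit [Fact (1 < L)] in
/-- Uniform bound on the doubled integrand (plumbing). [folklore] -/
private theorem norm_gramR2_le (c : ℕ → ℝ) (V Q : Finset (Plaquette d L))
    (q : GaugeConfig d L SU2 × GaugeConfig d L SU2) :
    ‖gramR2 c V Q q‖ ≤ ∑ x ∈ Fintype.piFinset (fun _ : Plaquette d L => (univ : Finset GIdx2)),
      |gramΓ2 c V Q x| *
        (((∏ _p ∈ (univ : Finset (Plaquette d L)).filter IsPosPlaq, (|(1 : ℝ)| + 2 * |2 * c 1| + 3 * |3 * c 2|)) *
            (2 : ℝ) ^ (univ : Finset (Plaquette d L)).card) *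
          ((∏ _p ∈ (univ : Finset (Plaquette d L)).filter IsPosPlaq, (|(1 : ℝ)| + 2 * |2 * c 1| + 3 * |3 * c 2|)) *
            (2 : ℝ) ^ (univ : Finset (Plaquette d L)).card)) := by
  unfold gramR2
  refine (norm_sum_le _ _).trans (Finset.sum_le_sum fun x _ => ?_)
  rw [norm_mul, Complex.norm_real, Real.norm_eq_abs, norm_mul, Complex.norm_conj]
  exact mul_le_mul_of_nonneg_left (mul_le_mul (norm_gramΦ2_le c x (LatticeRP.splice crossEdges q))
    (norm_gramΦ2_le c x q.1.timeReflect) (norm_nonneg _)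
    ((norm_nonneg _).trans (norm_gramΦ2_le c x (LatticeRP.splice crossEdges q)))) (abs_nonneg _)

open scoped ComplexOrder in
/-- **Reflection positivity of the twisted sectors at the cut-off `j ≤ 1`** (arXiv:0707.2179 App. A
§5: "every term in the sum (A.18) is manifestly non-negative by RP in `π`"), for the spin cut-off
`J = 2` of `TomboulisVortexDecimation` (characters `χ_{1/2}` and `χ_1`): on the even torus, for
`c_{1/2}, c_1 ≥ 0`, a twist set `V` of plaquettes bisected by the reflection hyperplanes and `Q ⊆ V`,
the `Q`-sector term of (A.18) is `≥ 0`. Proof as in `OneCharacterTwistBound.tTerm_nonneg`, the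
crossing weights `α + β Re tr U_p + γ χ_1(U_p)` being Gram kernels by `cross_factor_gram2` (the `Sym²`
identity `gram_quad`). [cite: Tomboulis2007Confinement, App. A §5] -/
theorem tSector_two_nonneg (hL : Even L) {c : ℕ → ℝ} (hc1 : 0 ≤ c 1) (hc2 : 0 ≤ c 2)
    {V Q : Finset (Plaquette d L)} (hV : ∀ p ∈ V, IsCrossPlaq p) (hQ : Q ⊆ V) :
    0 ≤ tSector d L 2 c V Q := by
  set μ : Measure (GaugeConfig d L SU2) := LatticeRP.piMeasure (haarProbability SU2) with hμ
  set H : GaugeConfig d L SU2 → ℝ := fun U => ∏ p : Plaquette d L, qw c V Q p U with hH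
  have hHm : Measurable H := by
    have h2 : H = fun U => ∏ p ∈ (univ : Finset (Plaquette d L)),
        (qα V Q p + qβ c V Q p * plaqRe rhoFund U p + qγ c V Q p * (plaqRe rhoFund U p ^ 2 - 1)) := by
      funext U
      simp only [hH, qw]
    rw [h2]
    exact measurable_prod_quad _ _ _ _
  have hHcm : Measurable fun U => ((H U : ℝ) : ℂ) := Complex.measurable_ofReal.comp hHm
  -- `tSector = ∫ H`
  have hT : tSector d L 2 c V Q = ∫ U, H U ∂μ := by
    unfold tSector
    exact integral_congr_ae (ae_of_all _ fun U => tSector_two_integrand_eq_prod c hQ U)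
  rw [hT]
  suffices key : 0 ≤ ∫ U, ((H U : ℝ) : ℂ) ∂μ by
    rw [integral_complex_ofReal] at key
    exact Complex.zero_le_real.1 key
  have hR : ∀ U Y, ((H (WilsonRP.translate Y U) : ℝ) : ℂ) = gramR2 c V Q (U, Y) :=
    fun U Y => integrand_translate2 hL c hV U Y
  have hRi : Integrable (gramR2 c V Q) (μ.prod μ) :=
    Integrable.of_bound (measurable_gramR2 c V Q).aestronglyMeasurable _
      (ae_of_all _ (norm_gramR2_le c V Q))
  have step1 : ∫ U, ((H U : ℝ) : ℂ) ∂μ = ∫ Y, ∫ U, gramR2 c V Q (U, Y) ∂μ ∂μ := by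
    have hY : ∀ Y, ∫ U, ((H U : ℝ) : ℂ) ∂μ = ∫ U, gramR2 c V Q (U, Y) ∂μ := fun Y => by
      rw [← LatticeRP.integral_comp_eq_of_measurePreserving (measurePreserving_translate Y) hHcm]
      exact integral_congr_ae (ae_of_all _ fun U => hR U Y)
    calc ∫ U, ((H U : ℝ) : ℂ) ∂μ = ∫ _Y, (∫ U, ((H U : ℝ) : ℂ) ∂μ) ∂μ := by
          rw [integral_const, probReal_univ, one_smul]
      _ = ∫ Y, ∫ U, gramR2 c V Q (U, Y) ∂μ ∂μ := integral_congr_ae (ae_of_all _ hY)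
  rw [step1, ← integral_prod_symm _ hRi]
  have hterm : ∀ x ∈ Fintype.piFinset (fun _ : Plaquette d L => (univ : Finset GIdx2)),
      Integrable (fun q : GaugeConfig d L SU2 × GaugeConfig d L SU2 =>
        ((gramΓ2 c V Q x : ℝ) : ℂ) * (gramΦ2 c x (LatticeRP.splice crossEdges q) *
          conj (gramΦ2 c x q.1.timeReflect))) (μ.prod μ) := by
    intro x _
    have hΦ := measurable_gramΦ2 c x
    refine Integrable.of_bound (measurable_const.mul ((hΦ.comp (LatticeRP.measurable_splice _)).mul
      (Complex.continuous_conj.measurable.comp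
        (hΦ.comp (measurable_timeReflect.comp measurable_fst))))).aestronglyMeasurable
      (|gramΓ2 c V Q x| *
        (((∏ _p ∈ (univ : Finset (Plaquette d L)).filter IsPosPlaq, (|(1 : ℝ)| + 2 * |2 * c 1| + 3 * |3 * c 2|)) *
            (2 : ℝ) ^ (univ : Finset (Plaquette d L)).card) *
          ((∏ _p ∈ (univ : Finset (Plaquette d L)).filter IsPosPlaq, (|(1 : ℝ)| + 2 * |2 * c 1| + 3 * |3 * c 2|)) *
            (2 : ℝ) ^ (univ : Finset (Plaquette d L)).card)))
      (ae_of_all _ fun q => ?_)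
    rw [norm_mul, Complex.norm_real, Real.norm_eq_abs, norm_mul, Complex.norm_conj]
    exact mul_le_mul_of_nonneg_left (mul_le_mul (norm_gramΦ2_le c x (LatticeRP.splice crossEdges q))
      (norm_gramΦ2_le c x q.1.timeReflect) (norm_nonneg _)
      ((norm_nonneg _).trans (norm_gramΦ2_le c x (LatticeRP.splice crossEdges q)))) (abs_nonneg _)
  unfold gramR2
  rw [integral_finsetSum _ hterm]
  refine Finset.sum_nonneg fun x _ => ?_
  rw [integral_const_mul]
  refine mul_nonneg (Complex.zero_le_real.2 (by exact_mod_cast gramΓ2_nonneg hc1 hc2 V Q x)) ?_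
  exact LatticeRP.integral_splice_mul_conj_comp_nonneg (haarProbability SU2) posEdges crossEdges
    GaugeConfig.timeReflect measurePreserving_timeReflect
    (fun e he => dependsOn_timeReflect_apply hL e he) (measurable_gramΦ2 c x) (norm_gramΦ2_le c x)
    (dependsOn_gramΦ2 hL c x)

/-! ### Prop. IV.1 at the cut-off `j ≤ 1` -/

/-- **Tomboulis's Prop. IV.1 for the spin cut-off `j ≤ 1`** (arXiv:0707.2179 eq. (4.6), App. A §5):
on the even torus, for `c_{1/2}, c_1 ≥ 0` and a twist set `V` of plaquettes bisected by the reflection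
hyperplanes, `Z⁻_Λ(V) ≤ Z_Λ` (via `torusZtw_le_torusZ_iff_sum_nonneg` and `tSector_two_nonneg`).
[cite: Tomboulis2007Confinement, Prop. IV.1 eq. (4.6); App. A §5] -/
theorem torusZtw_two_le_torusZ (hL : Even L) {c : ℕ → ℝ} (hc1 : 0 ≤ c 1) (hc2 : 0 ≤ c 2)
    {V : Finset (Plaquette d L)} (hV : ∀ p ∈ V, IsCrossPlaq p) :
    torusZtw d L 2 c V ≤ torusZ d L 2 c :=
  (torusZtw_le_torusZ_iff_sum_nonneg d L 2 c V).2 (Finset.sum_nonneg fun _ hQ =>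
    tSector_two_nonneg hL hc1 hc2 hV (Finset.mem_powerset.1 (Finset.mem_filter.1 hQ).1))

/-- **`-Z_Λ ≤ Z⁻_Λ(V)` at the cut-off `j ≤ 1`** (the even sectors, `torusZ_add_torusZtw_eq_sum`).
[cite: Tomboulis2007Confinement, §4.1 eq. (4.7); App. A §5] -/
theorem neg_torusZ_le_torusZtw_two (hL : Even L) {c : ℕ → ℝ} (hc1 : 0 ≤ c 1) (hc2 : 0 ≤ c 2)
    {V : Finset (Plaquette d L)} (hV : ∀ p ∈ V, IsCrossPlaq p) :
    -torusZ d L 2 c ≤ torusZtw d L 2 c V := by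
  have h := torusZ_add_torusZtw_eq_sum d L 2 c V
  have h2 : 0 ≤ ∑ Q ∈ V.powerset.filter (fun Q => Even Q.card), tSector d L 2 c V Q :=
    Finset.sum_nonneg fun Q hQ =>
      tSector_two_nonneg hL hc1 hc2 hV (Finset.mem_powerset.1 (Finset.mem_filter.1 hQ).1)
  linarith

/-- **`|Z⁻_Λ(V)| ≤ Z_Λ`** at the cut-off `j ≤ 1`.
[cite: Tomboulis2007Confinement, Prop. IV.1 eq. (4.6); §4.1 eq. (4.7)] -/
theorem abs_torusZtw_two_le_torusZ (hL : Even L) {c : ℕ → ℝ} (hc1 : 0 ≤ c 1) (hc2 : 0 ≤ c 2)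
    {V : Finset (Plaquette d L)} (hV : ∀ p ∈ V, IsCrossPlaq p) :
    |torusZtw d L 2 c V| ≤ torusZ d L 2 c :=
  abs_le.2 ⟨by linarith [neg_torusZ_le_torusZtw_two hL hc1 hc2 hV], torusZtw_two_le_torusZ hL hc1 hc2 hV⟩

/-- **`TwistLe d L 2 𝒱` — Prop. IV.1 for the spin cut-off `j ≤ 1`, on the even torus, for the vortex
sheet in every plane** (`d ≥ 2`): for every admissible coefficient sequence, `Z⁻_Λ ≤ Z_Λ`.
[cite: Tomboulis2007Confinement, Prop. IV.1 eq. (4.6); App. A §5] -/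
theorem twistLe_two_vortexSheet_plane (hL : Even L) (h01 : (0 : Fin d) < 1) {i j : Fin d}
    (hij : i < j) : TwistLe d L 2 (vortexSheet L i j hij) :=
  (twistLe_vortexSheet_iff_plane_zero_one h01 hij 2).2 fun _c hc =>
    torusZtw_two_le_torusZ hL (hc 1 le_rfl).1 (hc 2 (by norm_num)).1 (vortexSheet_isCrossPlaq 1 h01)

/-- **`|Z⁻_Λ/Z_Λ| ≤ 1` for the vortex sheet in every plane**, cut-off `j ≤ 1`, even torus,
`c_{1/2}, c_1 ≥ 0`, `Z_Λ ≠ 0`. [cite: Tomboulis2007Confinement, Prop. IV.1 eq. (4.6); §6 eq. (6.1)] -/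
theorem abs_vortexRatio_two_le_one_plane (hL : Even L) (h01 : (0 : Fin d) < 1) {c : ℕ → ℝ}
    (hc1 : 0 ≤ c 1) (hc2 : 0 ≤ c 2) {i j : Fin d} (hij : i < j) (hZ : torusZ d L 2 c ≠ 0) :
    |vortexRatio d L 2 c (vortexSheet L i j hij)| ≤ 1 := by
  rw [vortexRatio_vortexSheet_eq_plane_zero_one h01 hij]
  have hV := vortexSheet_isCrossPlaq (L := L) 1 h01
  have hZpos : 0 < torusZ d L 2 c := by
    rcases ((abs_nonneg (torusZtw d L 2 c (vortexSheet L 0 1 h01))).trans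
        (abs_torusZtw_two_le_torusZ hL hc1 hc2 hV)).lt_or_eq with h | h
    · exact h
    · exact absurd h.symm hZ
  unfold vortexRatio
  rw [abs_div, abs_of_pos hZpos, div_le_one hZpos]
  exact abs_torusZtw_two_le_torusZ hL hc1 hc2 hV


end RP

end Tomboulis2007

end Literature.MathematicalPhysics.QuantumFieldTheory

end
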